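import Literature.Analysis.FluidPDE.OnsagerBDSVThreeStages
import Literature.Analysis.FluidPDE.OnsagerBDSVParameters
import Literature.Analysis.FluidPDE.EulerReynoldsMollification
import Literature.Analysis.FunctionSpaces.HolderInterpolation
import Literature.Analysis.FunctionSpaces.TorusEnstrophyOrthogonality
import Literature.Analysis.FunctionSpaces.LadyzhenskayaTorus
import HarnessLib

/-!
# The BDSV mollification stage (Prop. 2.2): proof of the named fact `BDSV.mollificationStage`

Buckmaster–De Lellis–Székelyhidi–Vicol, *Onsager's conjecture for admissible weak solutions*,
CPAM 72 (2019) = arXiv:1701.08678, Prop. 2.2: from an Euler–Reynolds triple `(v_q, p_q, R̊_q)` on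
`[0,T] × T³` with (2.3) `‖R̊_q‖₀ ≤ δ_{q+1}λ_q^{-3α}` and (2.4) `‖v_q‖₁ ≤ Mδ_q^{1/2}λ_q`, the mollified
triple `(v_ℓ, p_ℓ, R̊_ℓ)` at length `ℓ = δ_{q+1}^{1/2}δ_q^{-1/2}λ_q^{-1-3α/2}` solves Euler–Reynolds
(2.10) and satisfies (2.12)–(2.15). `OnsagerBDSVThreeStages.lean` records this as the named fact
`BDSV.mollificationStage`; this file proves it (`BDSV.mollificationStage_holds`), following the
printed proof line by line, with the triple of `Torus.IsEulerReynoldsOn.mollify`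
(`EulerReynoldsMollification`):

* (2.12) `‖v_ℓ - v_q‖₀ ≤ ‖v_q‖₁ℓ ≲ δ_q^{1/2}λ_qℓ ≲ δ_{q+1}^{1/2}λ_q^{-α}`:
  `BDSV.norm_kernel_convolution_sub_self_le` and `ℓδ_q^{1/2}λ_q = δ_{q+1}^{1/2}λ_q^{-3α/2}`
  (`BDSV.mollScale_mul_sqrt_amp_mul_freq`);
* (2.13) `‖v_ℓ‖_{N+1} ≲ ‖v_q‖₁ℓ^{-N}`: all derivatives but one on the kernel
  (`TorusMollifierAllOrders`), packaged by `BDSV.eContDiffHolderNorm_mollifiedVelocity_le`;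
* (2.14) `‖R̊_ℓ‖_{N+α} ≲ ‖R̊_q‖₀ℓ^{-N-α} + ‖v_q‖₁²ℓ^{2-N-α} ≲ δ_{q+1}λ_q^{-3α}ℓ^{-N-α} ≤ δ_{q+1}ℓ^{-N+α}`:
  Prop. A.2 in every `C^N` (`TorusCommutatorAllOrders`) for the nine entries of the commutator
  tensor and its trace, the interpolation `[D^N·]_r ≤ ‖D^{N+1}·‖ℓ^{1-r} + 2‖D^N·‖ℓ^{-r}` of
  `HolderInterpolation` (`BDSV.eContDiffHolderNorm_le_tailSum`), `ℓ²δ_qλ_q² = δ_{q+1}λ_q^{-3α}`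
  (`BDSV.mollScale_sq_mul_sq`) and the lower half of (2.11), `λ_q^{-3/2} ≤ ℓ` hence
  `λ_q^{-3α} ≤ ℓ^{2α}` (`BDSV.exists_threshold_freq_rpow_le_mollScale`):
  `BDSV.eContDiffHolderNorm_mollifiedStress_le`;
* (2.15) `|∫|v_q|² - |v_ℓ|²| = |∫ tr C| ≲ ‖v_q‖₁²ℓ² ≤ δ_{q+1}ℓ^α` (`BDSV.abs_integral_norm_sq_sub_le`,
  unit mass of the kernel and the order-zero commutator bound).

Quantifiers: `α₀ = β` (for `α < β` the `a`-exponent `β(b-1) - 1/2 + 3α/2` of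
`λ_q^{-1/2-β+3α/2}λ_{q+1}^β ≤ 1 ⟺ λ_q^{-3/2} ≤ ℓ` is negative), the constants
`C_N = BDSV.mollConst M N` depend on `M, N` only, the threshold `a₀` on `β, b, α` (master lemma
`BDSV.exists_freq_triple_le`); `ℓ ≤ λ_q^{-1} ≤ (2π)^{-1} ≤ 1/4` (`BDSV.mollScale_le_quarter`) makes
the torus kernel available. The sup data `‖v_q‖₀ ≤ B₀`, `[v_q]₁ ≤ B₁` of (2.4) are turned into
`‖Dv_q‖, ‖D(v_q)ⱼ‖ ≤ 3B₁` (`Torus.norm_fderiv_le_sum_norm_partialDeriv`), and generic bounds for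
`pi`-valued derivatives and for `D^N(θ • e)` (namespace `Literature.Analysis.FluidPDE`) handle the
tensor `R̊_ℓ : T³ → (Fin 3 → ℝ³)`.

## References

* T. Buckmaster, C. De Lellis, L. Székelyhidi Jr., V. Vicol, *Onsager's conjecture for admissible
  weak solutions*, Comm. Pure Appl. Math. 72 (2019) 229–274 = arXiv:1701.08678: §2.4, Prop. 2.2
  with its proof, (2.10)–(2.15), (2.11); App. A (Hölder norms, (A.3), Prop. A.2).
-/

open MeasureTheory Set Filter
open scoped NNReal ENNReal ContDiff Convolution

noncomputable section

namespace Literature.Analysis.FluidPDE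

/-! ## Generic bounds: `pi`-valued derivatives, scalar times constant vector -/

section Generic

variable {F : Type*} [NormedAddCommGroup F] [NormedSpace ℝ F]

/-- Derivatives of `pi`-valued maps are controlled by those of the components:
`‖Dⁿ Φ(x)‖ ≤ ∑ⱼ ‖Dⁿ Φⱼ(x)‖` for `Φ : E → (ι → G)` of class `Cⁿ`. [folklore] -/
theorem norm_iteratedFDeriv_pi_le {E' : Type*} [NormedAddCommGroup E'] [NormedSpace ℝ E']
    {ι : Type*} [Fintype ι] {G : Type*} [NormedAddCommGroup G] [NormedSpace ℝ G]
    {Φ : E' → ι → G} {n : ℕ} {x : E'} (hΦ : ContDiffAt ℝ n Φ x) :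
    ‖iteratedFDeriv ℝ n Φ x‖ ≤ ∑ j, ‖iteratedFDeriv ℝ n (fun y => Φ y j) x‖ := by
  refine ContinuousMultilinearMap.opNorm_le_bound (Finset.sum_nonneg fun _ _ => norm_nonneg _)
    fun m => ?_
  rw [pi_norm_le_iff_of_nonneg (by positivity)]
  intro j
  have hcomp : (fun y => Φ y j) = (ContinuousLinearMap.proj (R := ℝ) (φ := fun _ : ι => G) j) ∘ Φ := rfl
  have h := ContinuousLinearMap.iteratedFDeriv_comp_left
    (ContinuousLinearMap.proj (R := ℝ) (φ := fun _ : ι => G) j) hΦ (i := n) le_rfl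
  rw [← hcomp] at h
  have happ : iteratedFDeriv ℝ n Φ x m j = iteratedFDeriv ℝ n (fun y => Φ y j) x m := by
    rw [h]; rfl
  rw [happ]
  calc ‖iteratedFDeriv ℝ n (fun y => Φ y j) x m‖
      ≤ ‖iteratedFDeriv ℝ n (fun y => Φ y j) x‖ * ∏ i, ‖m i‖ := ContinuousMultilinearMap.le_opNorm _ _
    _ ≤ (∑ j, ‖iteratedFDeriv ℝ n (fun y => Φ y j) x‖) * ∏ i, ‖m i‖ :=
        mul_le_mul_of_nonneg_right (Finset.single_le_sum (f := fun j =>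
          ‖iteratedFDeriv ℝ n (fun y => Φ y j) x‖) (fun _ _ => norm_nonneg _) (Finset.mem_univ j))
          (Finset.prod_nonneg fun _ _ => norm_nonneg _)

/-- `‖Dⁿ (θ • e)(x)‖ ≤ ‖e‖ ‖Dⁿ θ(x)‖` for a scalar `θ` and a constant vector `e`. [folklore] -/
theorem norm_iteratedFDeriv_smul_const_le {E' : Type*} [NormedAddCommGroup E'] [NormedSpace ℝ E']
    {θ : E' → ℝ} {n : ℕ} {x : E'} (hθ : ContDiffAt ℝ n θ x) (e : F) :
    ‖iteratedFDeriv ℝ n (fun y => θ y • e) x‖ ≤ ‖e‖ * ‖iteratedFDeriv ℝ n θ x‖ := by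
  have hcomp : (fun y => θ y • e) = ((ContinuousLinearMap.id ℝ ℝ).smulRight e) ∘ θ := by
    funext y; simp
  rw [hcomp]
  refine (ContinuousLinearMap.norm_iteratedFDeriv_comp_left _ hθ le_rfl).trans ?_
  rw [ContinuousLinearMap.norm_smulRight_apply, ContinuousLinearMap.norm_id, one_mul]

end Generic

namespace BDSV

open FunctionSpaces.Torus (lift kernel IsSmooth IsContDiff partialDeriv mollCommutator derivProfileMass
  shiftedDerivMass commConst)
open Torus (tensorTrace traceless mollTensorCommutator mollifyVelocity mollifyPressure mollifyStress)

/-! ## Slice estimates at a fixed time -/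

section Slice

/-- The flat three-torus `T³ = (ℝ/ℤ)³`, local notation. -/
local notation "𝕋³" => UnitAddTorus (Fin 3)

/-- Euclidean `ℝ³`, local notation. -/
local notation "ℝ³" => EuclideanSpace ℝ (Fin 3)

variable {ℓ : ℝ}

/-- **(2.12) at a fixed time**: `‖(v * ψ_ℓ)(x) - v(x)‖ ≤ c₀ ℓ ‖Dv‖_∞` for smooth `v` on `T³`
(`(v * ψ_ℓ)(x) - v(x) = (ψ_ℓ ⋆ (v - v(x)))(x)` and `|v - v(x)| ≤ ‖Dv‖_∞ ℓ` on the `ℓ`-ball;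
BDSV, proof of Prop. 2.2: "`‖v_ℓ - v_q‖₀ ≤ ‖v_q‖₁ ℓ`"). [cite: BuckmasterEtAl2018, Prop. 2.2 (2.12)] -/
theorem norm_kernel_convolution_sub_self_le {F : Type*} [NormedAddCommGroup F] [NormedSpace ℝ F]
    [CompleteSpace F] (hℓ : 0 < ℓ) (hℓ' : ℓ ≤ 1 / 4) {v : 𝕋³ → F} (hv : IsSmooth v) {A : ℝ}
    (hA : ∀ y, ‖FunctionSpaces.Torus.fderiv v y‖ ≤ A) (x : 𝕋³) :
    ‖(kernel ℓ ⋆ v) x - v x‖ ≤ derivProfileMass (Fin 3) 0 * ℓ * A := by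
  obtain ⟨x₀, rfl⟩ := FunctionSpaces.Torus.proj_surjective x
  have hκ : Integrable (kernel (d := Fin 3) ℓ) volume :=
    (FunctionSpaces.Torus.continuous_kernel hℓ hℓ').integrable_unitAddTorus
  set g : 𝕋³ → F := fun y => v y - v (FunctionSpaces.Torus.proj x₀) with hg
  have hgs : IsSmooth g := hv.sub (FunctionSpaces.Torus.isSmooth_const _)
  have hAg : ∀ y, ‖FunctionSpaces.Torus.fderiv g y‖ ≤ A := fun y => by
    rw [hg, FunctionSpaces.Torus.torusFderiv_sub_const]; exact hA y
  have hg0 : g (FunctionSpaces.Torus.proj x₀) = 0 := sub_self _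
  have h := FunctionSpaces.Torus.norm_iteratedFDeriv_lift_kernel_convolution_le_of_apply_eq_zero
    hℓ hℓ' hgs hAg x₀ hg0 0
  rw [norm_iteratedFDeriv_zero, FunctionSpaces.Torus.lift_apply, pow_zero, inv_one, mul_one] at h
  have hconv : (kernel ℓ ⋆ g) (FunctionSpaces.Torus.proj x₀) =
      (kernel ℓ ⋆ v) (FunctionSpaces.Torus.proj x₀) - v (FunctionSpaces.Torus.proj x₀) := by
    have e := FunctionSpaces.Torus.convolution_sub_right hκ hv.continuous continuous_const
      (k' := fun _ => v (FunctionSpaces.Torus.proj x₀)) (FunctionSpaces.Torus.proj x₀)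
    rw [FunctionSpaces.Torus.convolution_const_right, FunctionSpaces.Torus.integral_kernel hℓ hℓ',
      one_smul] at e
    exact e
  rw [hconv] at h
  simpa [shiftedDerivMass] using h

variable {v : 𝕋³ → ℝ³} {A B₀ : ℝ}

/-- **(2.13) at a fixed time, derivative by derivative**: for smooth `v` with `‖v‖ ≤ B₀` and
`‖Dv‖ ≤ A`, `‖(ψ_ℓ ⋆ v)‖ ≤ B₀` and `‖D^{j+1}(lift (ψ_ℓ ⋆ v))‖ ≤ c_j ℓ^{-j} A`; with
`M 0 = B₀`, `M (j+1) = c_j ℓ^{-j} A` this reads `‖D^j (lift (ψ_ℓ ⋆ v))(y)‖ ≤ M j` for all `j`.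
[cite: BuckmasterEtAl2018, Prop. 2.2 (2.13)] -/
theorem norm_iteratedFDeriv_lift_mollifiedVelocity_le (hℓ : 0 < ℓ) (hℓ' : ℓ ≤ 1 / 4)
    (hv : IsSmooth v) (hB₀ : ∀ y, ‖v y‖ ≤ B₀) (hA : ∀ y, ‖FunctionSpaces.Torus.fderiv v y‖ ≤ A)
    (y : EuclideanSpace ℝ (Fin 3)) :
    ∀ j : ℕ, ‖iteratedFDeriv ℝ j (lift (kernel ℓ ⋆ v)) y‖ ≤
      Nat.rec B₀ (fun i _ => derivProfileMass (Fin 3) i * (ℓ ^ i)⁻¹ * A) j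
  | 0 => by
    rw [norm_iteratedFDeriv_zero, FunctionSpaces.Torus.lift_apply]
    exact FunctionSpaces.Torus.norm_kernel_convolution_le hℓ hℓ' hB₀ _
  | j + 1 => FunctionSpaces.Torus.norm_iteratedFDeriv_succ_lift_kernel_convolution_le hℓ hℓ' hv j y hA

/-- The constant of (2.13): `K_N = 1 + ∑_{i ≤ N} c_i + c_{N+1} + 2 c_N`. [folklore] -/
def velConst (N : ℕ) : ℝ :=
  1 + ∑ i ∈ Finset.range (N + 1), derivProfileMass (Fin 3) i + derivProfileMass (Fin 3) (N + 1) +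
    2 * derivProfileMass (Fin 3) N

/-- `K_N ≥ 0`. [folklore] -/
theorem velConst_nonneg (N : ℕ) : 0 ≤ velConst N := by
  unfold velConst
  have := FunctionSpaces.Torus.derivProfileMass_nonneg (d := Fin 3) (N + 1)
  have := FunctionSpaces.Torus.derivProfileMass_nonneg (d := Fin 3) N
  have := Finset.sum_nonneg fun i (_ : i ∈ Finset.range (N + 1)) =>
    FunctionSpaces.Torus.derivProfileMass_nonneg (d := Fin 3) i
  positivity

/-- **(2.13) at a fixed time**: `‖ψ_ℓ ⋆ v‖_{C^{N+1,0}} ≤ K_N (B₀ + A) ℓ^{-N}` for smooth `v` with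
`‖v‖ ≤ B₀`, `‖Dv‖ ≤ A`, `0 < ℓ ≤ 1/4` (sum of the sup bounds of `D^j`, `j ≤ N+1`, and the
oscillation `≤ 2‖D^{N+1}‖` of the top derivative, via
`eContDiffHolderNorm_le_of_norm_iteratedFDeriv_le` with `δ = ℓ`; `ℓ ≤ 1` turns every `ℓ^{-i}`,
`i ≤ N`, into `ℓ^{-N}`). [cite: BuckmasterEtAl2018, Prop. 2.2 (2.13)] -/
theorem eContDiffHolderNorm_mollifiedVelocity_le (hℓ : 0 < ℓ) (hℓ' : ℓ ≤ 1 / 4)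
    (hv : IsSmooth v) (hB₀ : ∀ y, ‖v y‖ ≤ B₀) (hA : ∀ y, ‖FunctionSpaces.Torus.fderiv v y‖ ≤ A)
    (N : ℕ) :
    FunctionSpaces.Torus.eContDiffHolderNorm (N + 1) 0 (kernel ℓ ⋆ v) ≤
      ENNReal.ofReal (velConst N * (B₀ + A) * (ℓ ^ N)⁻¹) := by
  have hℓ1 : ℓ ≤ 1 := hℓ'.trans (by norm_num)
  have hA0 : 0 ≤ A := (norm_nonneg _).trans (hA 0)
  have hB0 : 0 ≤ B₀ := (norm_nonneg _).trans (hB₀ 0)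
  have hκ : Integrable (kernel (d := Fin 3) ℓ) volume :=
    (FunctionSpaces.Torus.continuous_kernel hℓ hℓ').integrable_unitAddTorus
  have hsm : ContDiff ℝ ((N + 1 : ℕ) + 1) (lift (kernel ℓ ⋆ v)) :=
    (FunctionSpaces.Torus.isSmooth_convolution hκ hv).of_le (by exact_mod_cast le_top)
  set M : ℕ → ℝ := fun j => Nat.rec B₀ (fun i _ => derivProfileMass (Fin 3) i * (ℓ ^ i)⁻¹ * A) j with hM
  have hM0 : ∀ j, 0 ≤ M j := by
    intro j; cases j with
    | zero => exact hB0
    | succ i => exact mul_nonneg (mul_nonneg (FunctionSpaces.Torus.derivProfileMass_nonneg i)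
        (by positivity)) hA0
  have hMb : ∀ j ≤ (N + 1) + 1, ∀ y, ‖iteratedFDeriv ℝ j (lift (kernel ℓ ⋆ v)) y‖ ≤ M j :=
    fun j _ y => norm_iteratedFDeriv_lift_mollifiedVelocity_le hℓ hℓ' hv hB₀ hA y j
  refine (FunctionSpaces.eContDiffHolderNorm_le_of_norm_iteratedFDeriv_le hsm hM0 hMb
    (r := 0) zero_le_one hℓ).trans (ENNReal.ofReal_le_ofReal ?_)
  -- compare the bound with `K_N (B₀ + A) ℓ^{-N}`
  have hpow : ∀ i ≤ N, (ℓ ^ i)⁻¹ ≤ (ℓ ^ N)⁻¹ := fun i hi =>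
    inv_anti₀ (pow_pos hℓ N) (pow_le_pow_of_le_one hℓ.le hℓ1 hi)
  have hN1 : 1 ≤ (ℓ ^ N)⁻¹ := one_le_inv_iff₀.2 ⟨pow_pos hℓ N, pow_le_one₀ hℓ.le hℓ1⟩
  simp only [NNReal.coe_zero, sub_zero, Real.rpow_one, Real.rpow_zero, mul_one]
  -- the sum `∑_{j ≤ N+1} M j = B₀ + ∑_{i ≤ N} c_i ℓ^{-i} A`
  rw [Finset.sum_range_succ']
  have hsum : ∑ i ∈ Finset.range (N + 1), M (i + 1) ≤
      (∑ i ∈ Finset.range (N + 1), derivProfileMass (Fin 3) i) * ((B₀ + A) * (ℓ ^ N)⁻¹) := by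
    rw [Finset.sum_mul]
    refine Finset.sum_le_sum fun i hi => ?_
    have hi' : i ≤ N := Nat.lt_succ_iff.1 (Finset.mem_range.1 hi)
    show derivProfileMass (Fin 3) i * (ℓ ^ i)⁻¹ * A ≤ _
    rw [mul_assoc]
    refine mul_le_mul_of_nonneg_left ?_ (FunctionSpaces.Torus.derivProfileMass_nonneg i)
    calc (ℓ ^ i)⁻¹ * A ≤ (ℓ ^ N)⁻¹ * A := mul_le_mul_of_nonneg_right (hpow i hi') hA0
      _ ≤ (B₀ + A) * (ℓ ^ N)⁻¹ := by rw [mul_comm]; nlinarith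
  have h0 : M 0 ≤ (B₀ + A) * (ℓ ^ N)⁻¹ := by
    show B₀ ≤ _; nlinarith
  have hN2 : M (N + 1 + 1) * ℓ = derivProfileMass (Fin 3) (N + 1) * (ℓ ^ N)⁻¹ * A := by
    show derivProfileMass (Fin 3) (N + 1) * (ℓ ^ (N + 1))⁻¹ * A * ℓ = _
    rw [pow_succ, mul_inv]
    field_simp
  have hN2' : M (N + 1 + 1) * ℓ ≤ derivProfileMass (Fin 3) (N + 1) * ((B₀ + A) * (ℓ ^ N)⁻¹) := by
    rw [hN2, mul_assoc]
    refine mul_le_mul_of_nonneg_left ?_ (FunctionSpaces.Torus.derivProfileMass_nonneg _)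
    rw [mul_comm]; nlinarith
  have hN1' : 2 * M (N + 1) ≤ 2 * derivProfileMass (Fin 3) N * ((B₀ + A) * (ℓ ^ N)⁻¹) := by
    show 2 * (derivProfileMass (Fin 3) N * (ℓ ^ N)⁻¹ * A) ≤ _
    have := FunctionSpaces.Torus.derivProfileMass_nonneg (d := Fin 3) N
    nlinarith [mul_nonneg this (le_of_lt (inv_pos.2 (pow_pos hℓ N)))]
  unfold velConst
  nlinarith [hsum, h0, hN2', hN1', mul_nonneg (add_nonneg hB0 hA0) (le_of_lt (inv_pos.2 (pow_pos hℓ N)))]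

/-- The combination `∑_{i ≤ N} m_i + m_{N+1} + 2 m_N` of a family of constants, which bounds the
`C^{N,r}` norm when `‖Dⁱh‖ ≤ mᵢ ℓ^{-i}` (`tailSum_packaging`). [folklore] -/
def tailSum (m : ℕ → ℝ) (N : ℕ) : ℝ := ∑ i ∈ Finset.range (N + 1), m i + m (N + 1) + 2 * m N

/-- `tailSum` of a nonnegative family is nonnegative. [folklore] -/
theorem tailSum_nonneg {m : ℕ → ℝ} (hm : ∀ i, 0 ≤ m i) (N : ℕ) : 0 ≤ tailSum m N := by
  unfold tailSum
  have := Finset.sum_nonneg fun i (_ : i ∈ Finset.range (N + 1)) => hm i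
  have := hm (N + 1); have := hm N
  positivity

/-- `tailSum` is linear: `tailSum (a m + b m') = a tailSum m + b tailSum m'`. [folklore] -/
theorem tailSum_linear (m m' : ℕ → ℝ) (a b : ℝ) (N : ℕ) :
    tailSum (fun i => a * m i + b * m' i) N = a * tailSum m N + b * tailSum m' N := by
  unfold tailSum
  rw [Finset.sum_add_distrib, ← Finset.mul_sum, ← Finset.mul_sum]
  ring

/-- **Packaging at scale `ℓ`**: if `h ∈ C^{N+1}` satisfies `‖Dⁱ h‖ ≤ mᵢ ℓ^{-i}` for `i ≤ N + 1`
(`mᵢ ≥ 0`, `0 < ℓ ≤ 1`), then for `r ≤ 1`,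
`‖h‖_{C^{N,r}} ≤ (∑_{i ≤ N} mᵢ + m_{N+1} + 2 m_N) ℓ^{-N} ℓ^{-r}`
(`eContDiffHolderNorm_le_of_norm_iteratedFDeriv_le` with `δ = ℓ`: the interpolated Hölder
seminorm is `m_{N+1} ℓ^{-N-1} ℓ^{1-r} + 2 m_N ℓ^{-N} ℓ^{-r}`, and `ℓ^{-i} ≤ ℓ^{-N} ℓ^{-r}`). [folklore] -/
theorem eContDiffHolderNorm_le_tailSum {E' : Type*} [NormedAddCommGroup E'] [NormedSpace ℝ E']
    {Y : Type*} [NormedAddCommGroup Y] [NormedSpace ℝ Y] {h : E' → Y} {N : ℕ}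
    (hh : ContDiff ℝ (N + 1) h) (hℓ : 0 < ℓ) (hℓ1 : ℓ ≤ 1) {m : ℕ → ℝ} (hm : ∀ i, 0 ≤ m i)
    (hb : ∀ i ≤ N + 1, ∀ y, ‖iteratedFDeriv ℝ i h y‖ ≤ m i * (ℓ ^ i)⁻¹) {r : ℝ≥0} (hr : r ≤ 1) :
    FunctionSpaces.eContDiffHolderNorm N r h ≤
      ENNReal.ofReal (tailSum m N * ((ℓ ^ N)⁻¹ * ℓ ^ (-(r : ℝ)))) := by
  have hM0 : ∀ i, 0 ≤ m i * (ℓ ^ i)⁻¹ := fun i => mul_nonneg (hm i) (by positivity)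
  refine (FunctionSpaces.eContDiffHolderNorm_le_of_norm_iteratedFDeriv_le hh hM0 hb hr hℓ).trans
    (ENNReal.ofReal_le_ofReal ?_)
  have hr0 : (0 : ℝ) ≤ r := r.2
  have hℓr : 1 ≤ ℓ ^ (-(r : ℝ)) := Real.one_le_rpow_of_pos_of_le_one_of_nonpos hℓ hℓ1 (by linarith)
  have hpow : ∀ i ≤ N, (ℓ ^ i)⁻¹ ≤ (ℓ ^ N)⁻¹ * ℓ ^ (-(r : ℝ)) := fun i hi =>
    calc (ℓ ^ i)⁻¹ ≤ (ℓ ^ N)⁻¹ := inv_anti₀ (pow_pos hℓ N) (pow_le_pow_of_le_one hℓ.le hℓ1 hi)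
      _ = (ℓ ^ N)⁻¹ * 1 := (mul_one _).symm
      _ ≤ (ℓ ^ N)⁻¹ * ℓ ^ (-(r : ℝ)) := mul_le_mul_of_nonneg_left hℓr (by positivity)
  have h1 : ∑ i ∈ Finset.range (N + 1), m i * (ℓ ^ i)⁻¹ ≤
      (∑ i ∈ Finset.range (N + 1), m i) * ((ℓ ^ N)⁻¹ * ℓ ^ (-(r : ℝ))) := by
    rw [Finset.sum_mul]
    exact Finset.sum_le_sum fun i hi =>
      mul_le_mul_of_nonneg_left (hpow i (Nat.lt_succ_iff.1 (Finset.mem_range.1 hi))) (hm i)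
  have h2 : m (N + 1) * (ℓ ^ (N + 1))⁻¹ * ℓ ^ (1 - r : ℝ) = m (N + 1) * ((ℓ ^ N)⁻¹ * ℓ ^ (-(r : ℝ))) := by
    rw [show (1 - r : ℝ) = 1 + -(r : ℝ) by ring, Real.rpow_add hℓ, Real.rpow_one, pow_succ, mul_inv]
    field_simp
  have h3 : 2 * (m N * (ℓ ^ N)⁻¹) * ℓ⁻¹ ^ (r : ℝ) = 2 * m N * ((ℓ ^ N)⁻¹ * ℓ ^ (-(r : ℝ))) := by
    rw [Real.inv_rpow hℓ.le, Real.rpow_neg hℓ.le]; ring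
  rw [h2, h3]
  unfold tailSum
  nlinarith [h1, hm (N + 1), hm N, mul_pos (inv_pos.2 (pow_pos hℓ N)) (lt_of_lt_of_le one_pos hℓr)]

variable {R : 𝕋³ → Fin 3 → ℝ³} {B : ℝ}

/-- **(2.14) at a fixed time, derivative by derivative**: for smooth `v, R` on `T³` with
`‖R‖ ≤ B`, `‖Dv‖ ≤ A` and `‖Dvⱼ‖ ≤ A` (`0 < ℓ ≤ 1/4`), the mollified stress
`R_ℓ = ψ_ℓ ⋆ R - C̊`, `C = C_ℓ(v)`, satisfies
`‖Dⁿ(lift R_ℓ)‖ ≤ c_n ℓ^{-n} B + 6 K_n ℓ² ℓ^{-n} A²` (derivatives on the kernel for `ψ_ℓ ⋆ R`;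
the commutator estimate `norm_iteratedFDeriv_lift_mollCommutator_le` for the nine entries of `C`
and its trace). [cite: BuckmasterEtAl2018, Prop. 2.2 (2.14)] -/
theorem norm_iteratedFDeriv_lift_mollifiedStress_le (hℓ : 0 < ℓ) (hℓ' : ℓ ≤ 1 / 4)
    (hv : IsSmooth v) (hR : IsSmooth R) (hA : ∀ y, ‖FunctionSpaces.Torus.fderiv v y‖ ≤ A)
    (hAj : ∀ j y, ‖FunctionSpaces.Torus.fderiv (fun z => v z j) y‖ ≤ A) (hB : ∀ y, ‖R y‖ ≤ B)
    (n : ℕ) (y : EuclideanSpace ℝ (Fin 3)) :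
    ‖iteratedFDeriv ℝ n (lift (fun x j => (kernel ℓ ⋆ R) x j - traceless (mollTensorCommutator ℓ v) x j)) y‖ ≤
      derivProfileMass (Fin 3) n * (ℓ ^ n)⁻¹ * B +
        6 * commConst (Fin 3) n * (ℓ ^ 2 * (ℓ ^ n)⁻¹) * A ^ 2 := by
  have hκ : Integrable (kernel (d := Fin 3) ℓ) volume :=
    (FunctionSpaces.Torus.continuous_kernel hℓ hℓ').integrable_unitAddTorus
  have hA0 : 0 ≤ A := (norm_nonneg _).trans (hA 0)
  set C := mollTensorCommutator ℓ v with hCdef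
  have hC : IsSmooth C := hv.mollTensorCommutator hℓ hℓ'
  have hKR : IsSmooth (kernel ℓ ⋆ R) := FunctionSpaces.Torus.isSmooth_convolution hκ hR
  have hCt : IsSmooth (traceless C) := hC.traceless
  have htop : ∀ {G : Type} [NormedAddCommGroup G] [NormedSpace ℝ G] {g : 𝕋³ → G},
      IsSmooth g → ContDiffAt ℝ n (lift g) y := fun hg => (hg.of_le (by exact_mod_cast le_top)).contDiffAt
  -- split `R_ℓ = ψ_ℓ ⋆ R - C̊`
  have hsplit : lift (fun x j => (kernel ℓ ⋆ R) x j - traceless C x j) = lift (kernel ℓ ⋆ R) - lift (traceless C) := by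
    funext z; rfl
  rw [hsplit, iteratedFDeriv_sub_apply (htop hKR) (htop hCt)]
  refine (norm_sub_le _ _).trans (add_le_add
    (FunctionSpaces.Torus.norm_iteratedFDeriv_lift_kernel_convolution_le_of_forall_le hℓ hℓ' hR n y hB) ?_)
  -- the traceless commutator tensor, column by column
  have hcomm : ∀ j, ‖iteratedFDeriv ℝ n (lift (mollCommutator ℓ (fun z => v z j) v)) y‖ ≤
      commConst (Fin 3) n * (ℓ ^ 2 * (ℓ ^ n)⁻¹) * A * A := fun j =>
    FunctionSpaces.Torus.norm_iteratedFDeriv_lift_mollCommutator_le hℓ hℓ' (hv.apply j) hv (hAj j) hA n y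
  have hcommjj : ∀ j, ‖iteratedFDeriv ℝ n (lift (mollCommutator ℓ (fun z => v z j) fun z => v z j)) y‖ ≤
      commConst (Fin 3) n * (ℓ ^ 2 * (ℓ ^ n)⁻¹) * A * A := fun j =>
    FunctionSpaces.Torus.norm_iteratedFDeriv_lift_mollCommutator_le hℓ hℓ' (hv.apply j) (hv.apply j)
      (hAj j) (hAj j) n y
  -- the trace `θ = tr C / 3`
  set θ : 𝕋³ → ℝ := fun x => tensorTrace C x / Fintype.card (Fin 3) with hθdef
  have hθeq : lift θ = fun z => (Fintype.card (Fin 3) : ℝ)⁻¹ •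
      ∑ i, lift (mollCommutator ℓ (fun w => v w i) fun w => v w i) z := by
    funext z
    simp only [hθdef, FunctionSpaces.Torus.lift_apply, tensorTrace, smul_eq_mul, div_eq_inv_mul]
    congr 1
    refine Finset.sum_congr rfl fun i _ => ?_
    exact Torus.mollTensorCommutator_apply_apply hℓ hℓ' hv.continuous _ i i
  have hcii : ∀ i, IsSmooth (mollCommutator ℓ (fun w => v w i) fun w => v w i) := fun i =>
    FunctionSpaces.Torus.isSmooth_mollCommutator hℓ hℓ' (hv.apply i) (hv.apply i)
  have hθb : ‖iteratedFDeriv ℝ n (lift θ) y‖ ≤ commConst (Fin 3) n * (ℓ ^ 2 * (ℓ ^ n)⁻¹) * A * A := by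
    rw [hθeq, iteratedFDeriv_const_smul_apply' (x := y)
        (ContDiffAt.sum fun i _ => htop (hcii i)),
      iteratedFDeriv_fun_sum_apply fun i _ => htop (hcii i), norm_smul, norm_inv,
      Real.norm_natCast, Fintype.card_fin]
    calc (3 : ℝ)⁻¹ * ‖∑ i, iteratedFDeriv ℝ n (lift (mollCommutator ℓ (fun w => v w i) fun w => v w i)) y‖
        ≤ 3⁻¹ * ∑ i : Fin 3, commConst (Fin 3) n * (ℓ ^ 2 * (ℓ ^ n)⁻¹) * A * A :=
          mul_le_mul_of_nonneg_left ((norm_sum_le _ _).trans (Finset.sum_le_sum fun i _ => hcommjj i))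
            (by norm_num)
      _ = commConst (Fin 3) n * (ℓ ^ 2 * (ℓ ^ n)⁻¹) * A * A := by
          rw [Finset.sum_const, Finset.card_univ, Fintype.card_fin, nsmul_eq_mul]; ring
  -- each column of `C̊`
  have hθs : IsSmooth θ := ContDiff.div_const hC.tensorTrace _
  have hcol : ∀ j, ‖iteratedFDeriv ℝ n (fun z => lift (traceless C) z j) y‖ ≤
      2 * (commConst (Fin 3) n * (ℓ ^ 2 * (ℓ ^ n)⁻¹) * A * A) := by
    intro j
    have hfun : (fun z => lift (traceless C) z j) =
        lift (mollCommutator ℓ (fun w => v w j) v) - fun z => lift θ z • EuclideanSpace.single j (1 : ℝ) := by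
      funext z; rfl
    rw [hfun, iteratedFDeriv_sub_apply (f := lift (mollCommutator ℓ (fun w => v w j) v))
      (g := fun z => lift θ z • EuclideanSpace.single j (1 : ℝ))
      (htop (FunctionSpaces.Torus.isSmooth_mollCommutator hℓ hℓ' (hv.apply j) hv))
      ((htop hθs).smul contDiffAt_const)]
    refine (norm_sub_le _ _).trans ?_
    have h2 := norm_iteratedFDeriv_smul_const_le (htop hθs) (EuclideanSpace.single j (1 : ℝ))
    rw [show ‖EuclideanSpace.single j (1 : ℝ)‖ = 1 by
      rw [EuclideanSpace.single, PiLp.norm_single, norm_one], one_mul] at h2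
    linarith [hcomm j, h2.trans hθb]
  calc ‖iteratedFDeriv ℝ n (lift (traceless C)) y‖
      ≤ ∑ j, ‖iteratedFDeriv ℝ n (fun z => lift (traceless C) z j) y‖ := norm_iteratedFDeriv_pi_le (htop hCt)
    _ ≤ ∑ _j : Fin 3, 2 * (commConst (Fin 3) n * (ℓ ^ 2 * (ℓ ^ n)⁻¹) * A * A) :=
        Finset.sum_le_sum fun j _ => hcol j
    _ = 6 * commConst (Fin 3) n * (ℓ ^ 2 * (ℓ ^ n)⁻¹) * A ^ 2 := by
        rw [Finset.sum_const, Finset.card_univ, Fintype.card_fin, nsmul_eq_mul]; ring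

/-- **(2.14) at a fixed time**: for `0 < ℓ ≤ 1/4`, `r ≤ 1`,
`‖R_ℓ‖_{C^{N,r}} ≤ (S_c(N) B + 6 S_K(N) ℓ² A²) ℓ^{-N} ℓ^{-r}` with
`S_c = tailSum c`, `S_K = tailSum K` (`norm_iteratedFDeriv_lift_mollifiedStress_le` packaged by
`eContDiffHolderNorm_le_tailSum`). [cite: BuckmasterEtAl2018, Prop. 2.2 (2.14)] -/
theorem eContDiffHolderNorm_mollifiedStress_le (hℓ : 0 < ℓ) (hℓ' : ℓ ≤ 1 / 4)
    (hv : IsSmooth v) (hR : IsSmooth R) (hA : ∀ y, ‖FunctionSpaces.Torus.fderiv v y‖ ≤ A)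
    (hAj : ∀ j y, ‖FunctionSpaces.Torus.fderiv (fun z => v z j) y‖ ≤ A) (hB : ∀ y, ‖R y‖ ≤ B)
    (N : ℕ) {r : ℝ≥0} (hr : r ≤ 1) :
    FunctionSpaces.Torus.eContDiffHolderNorm N r
        (fun x j => (kernel ℓ ⋆ R) x j - traceless (mollTensorCommutator ℓ v) x j) ≤
      ENNReal.ofReal ((tailSum (derivProfileMass (Fin 3)) N * B +
        6 * tailSum (commConst (Fin 3)) N * (ℓ ^ 2 * A ^ 2)) * ((ℓ ^ N)⁻¹ * ℓ ^ (-(r : ℝ)))) := by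
  have hℓ1 : ℓ ≤ 1 := hℓ'.trans (by norm_num)
  have hB0 : 0 ≤ B := (norm_nonneg _).trans (hB 0)
  have hκ : Integrable (kernel (d := Fin 3) ℓ) volume :=
    (FunctionSpaces.Torus.continuous_kernel hℓ hℓ').integrable_unitAddTorus
  have hsm : IsSmooth (fun x j => (kernel ℓ ⋆ R) x j - traceless (mollTensorCommutator ℓ v) x j) :=
    Torus.isSmooth_tensor fun j => ((FunctionSpaces.Torus.isSmooth_convolution hκ hR).column j).sub
      ((hv.mollTensorCommutator hℓ hℓ').traceless.column j)
  set m : ℕ → ℝ := fun i => B * derivProfileMass (Fin 3) i + (6 * (ℓ ^ 2 * A ^ 2)) * commConst (Fin 3) i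
    with hmdef
  have hm : ∀ i, 0 ≤ m i := fun i => add_nonneg (mul_nonneg hB0 (FunctionSpaces.Torus.derivProfileMass_nonneg i))
    (mul_nonneg (by positivity) (FunctionSpaces.Torus.commConst_nonneg i))
  have hb : ∀ i ≤ N + 1, ∀ y, ‖iteratedFDeriv ℝ i (lift (fun x j => (kernel ℓ ⋆ R) x j -
      traceless (mollTensorCommutator ℓ v) x j)) y‖ ≤ m i * (ℓ ^ i)⁻¹ := by
    intro i _ y
    refine (norm_iteratedFDeriv_lift_mollifiedStress_le hℓ hℓ' hv hR hA hAj hB i y).trans (le_of_eq ?_)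
    simp only [hmdef]; ring
  have h := eContDiffHolderNorm_le_tailSum (hsm.of_le (by exact_mod_cast le_top)) hℓ hℓ1 hm hb hr
  refine h.trans (le_of_eq ?_)
  congr 2
  rw [hmdef, tailSum_linear]
  ring

/-- **(2.15) at a fixed time**: `|∫ |v|² - ∫ |ψ_ℓ ⋆ v|²| ≤ 3 K₀ ℓ² A²` for smooth `v` on `T³` with
`‖Dvⱼ‖ ≤ A` (`∫ |v|² = ∫ ψ_ℓ ⋆ |v|²` by unit mass, so the difference is `∫ tr C_ℓ(v) = ∑ⱼ ∫ B_ℓ(vⱼ, vⱼ)`,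
each bounded by the commutator estimate at order `0`; BDSV, proof of Prop. 2.2:
"`|∫ |v_q|² - |v_ℓ|²| = |∫ (|v_q|²)_ℓ - |v_ℓ|²| ≲ ‖(|v_q|²)_ℓ - |v_ℓ|²‖₀ ≲ ‖v_q‖₁² ℓ²`").
[cite: BuckmasterEtAl2018, Prop. 2.2 (2.15)] -/
theorem abs_integral_norm_sq_sub_le (hℓ : 0 < ℓ) (hℓ' : ℓ ≤ 1 / 4) (hv : IsSmooth v)
    (hAj : ∀ j y, ‖FunctionSpaces.Torus.fderiv (fun z => v z j) y‖ ≤ A) :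
    |(∫ x, ‖v x‖ ^ 2) - ∫ x, ‖(kernel ℓ ⋆ v) x‖ ^ 2| ≤ 3 * commConst (Fin 3) 0 * ℓ ^ 2 * A ^ 2 := by
  have hκc : Continuous (kernel (d := Fin 3) ℓ) := FunctionSpaces.Torus.continuous_kernel hℓ hℓ'
  have hκ : Integrable (kernel (d := Fin 3) ℓ) volume := hκc.integrable_unitAddTorus
  have hvj : ∀ j, IsSmooth fun z => v z j := fun j => hv.apply j
  have hvℓ : IsSmooth (kernel ℓ ⋆ v) := FunctionSpaces.Torus.isSmooth_convolution hκ hv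
  -- `‖w‖² = ∑ⱼ wⱼ²`
  have hsq : ∀ w : ℝ³, ‖w‖ ^ 2 = ∑ j, w j ^ 2 := fun w => by
    rw [EuclideanSpace.norm_sq_eq]; simp [sq_abs]
  -- mass preservation `∫ ψ_ℓ ⋆ g = ∫ g`
  have hmass : ∀ {g : 𝕋³ → ℝ}, IsSmooth g → ∫ x, (kernel ℓ ⋆ g) x = ∫ x, g x := fun hg => by
    rw [integral_convolution (ContinuousLinearMap.lsmul ℝ ℝ) hκ hg.integrable,
      FunctionSpaces.Torus.integral_kernel hℓ hℓ', ContinuousLinearMap.lsmul_apply, one_smul]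
  -- reduce to the commutators `B_ℓ(vⱼ, vⱼ)`
  have hdiff : (∫ x, ‖v x‖ ^ 2) - ∫ x, ‖(kernel ℓ ⋆ v) x‖ ^ 2 =
      ∑ j, ∫ x, mollCommutator ℓ (fun z => v z j) (fun z => v z j) x := by
    simp_rw [hsq]
    rw [integral_finsetSum _ (f := fun j x => v x j ^ 2) fun j _ =>
        ((hvj j).continuous.pow 2).integrable_unitAddTorus,
      integral_finsetSum _ (f := fun j x => (kernel ℓ ⋆ v) x j ^ 2) fun j _ =>
        ((hvℓ.apply j).continuous.pow 2).integrable_unitAddTorus,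
      ← Finset.sum_sub_distrib]
    refine Finset.sum_congr rfl fun j _ => ?_
    have h1 : IsSmooth fun z => v z j ^ 2 := (hvj j).pow 2
    rw [← hmass h1, ← integral_sub (FunctionSpaces.Torus.isSmooth_convolution hκ h1).integrable
      (g := fun a => (kernel ℓ ⋆ v) a j ^ 2) ((hvℓ.apply j).continuous.pow 2).integrable_unitAddTorus]
    refine integral_congr_ae (Eventually.of_forall fun x => ?_)
    simp only [FunctionSpaces.Torus.mollCommutator_apply, smul_eq_mul, sq]
    rw [Torus.convolution_apply_euclidean hκ hv.continuous x j]
  rw [hdiff]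
  calc |∑ j, ∫ x, mollCommutator ℓ (fun z => v z j) (fun z => v z j) x|
      ≤ ∑ j, |∫ x, mollCommutator ℓ (fun z => v z j) (fun z => v z j) x| := Finset.abs_sum_le_sum_abs _ _
    _ ≤ ∑ _j : Fin 3, commConst (Fin 3) 0 * ℓ ^ 2 * A * A := Finset.sum_le_sum fun j _ => by
        rw [← Real.norm_eq_abs]
        have h := norm_integral_le_of_norm_le_const (μ := (volume : Measure 𝕋³))
          (f := mollCommutator ℓ (fun z => v z j) (fun z => v z j)) (C := commConst (Fin 3) 0 * ℓ ^ 2 * A * A)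
          (Eventually.of_forall fun x => FunctionSpaces.Torus.norm_mollCommutator_le hℓ hℓ' (hvj j) (hvj j)
            (hAj j) (hAj j) x)
        simpa using h
    _ = 3 * commConst (Fin 3) 0 * ℓ ^ 2 * A ^ 2 := by
        rw [Finset.sum_const, Finset.card_univ, Fintype.card_fin, nsmul_eq_mul]; ring

end Slice

/-! ## Parameter identities and the threshold in `a` -/

section Parameters

variable {β α a b : ℝ}

/-- `ℓ δ_q^{1/2} λ_q = δ_{q+1}^{1/2} λ_q^{-3α/2}` (definition of `ℓ`, (2.10)′; BDSV, proof of
Prop. 2.2: "`δ_q^{1/2} λ_q ℓ ≲ δ_{q+1}^{1/2} λ_q^{-α}`"). [cite: BuckmasterEtAl2018, §2.4] -/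
theorem mollScale_mul_sqrt_amp_mul_freq (ha : 1 ≤ a) (q : ℕ) :
    mollScale β α a b q * (Real.sqrt (amp β a b q) * freq a b q) =
      Real.sqrt (amp β a b (q + 1)) * freq a b q ^ (-(3 * α / 2)) := by
  have hf := freq_pos (b := b) ha q
  have hs : 0 < Real.sqrt (amp β a b q) := Real.sqrt_pos.2 (amp_pos ha q)
  have hp : 0 < freq a b q ^ (3 * α / 2) := Real.rpow_pos_of_pos hf _
  unfold mollScale
  rw [Real.rpow_add hf, Real.rpow_one, Real.rpow_neg hf.le]
  field_simp

/-- `ℓ² δ_q λ_q² = δ_{q+1} λ_q^{-3α}` (the square of `mollScale_mul_sqrt_amp_mul_freq`; the identity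
behind "`δ_q λ_q² ℓ² ℓ^{-N-α} ≲ δ_{q+1} λ_q^{-3α} ℓ^{-N-α}`" in the proof of (2.14)).
[cite: BuckmasterEtAl2018, Prop. 2.2] -/
theorem mollScale_sq_mul_sq (ha : 1 ≤ a) (q : ℕ) :
    mollScale β α a b q ^ 2 * (Real.sqrt (amp β a b q) * freq a b q) ^ 2 =
      amp β a b (q + 1) * freq a b q ^ (-(3 * α)) := by
  rw [← mul_pow, mollScale_mul_sqrt_amp_mul_freq ha q, mul_pow, Real.sq_sqrt (amp_pos ha _).le,
    ← Real.rpow_natCast (freq a b q ^ (-(3 * α / 2))) 2, ← Real.rpow_mul (freq_pos ha q).le]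
  congr 1
  push_cast
  ring

/-- **The lower half of (2.11) for `α < β`**: for `0 < β`, `1 < b < (1-β)/(2β)` and `α < β`
there is `a₁ > 1` such that `λ_q^{-3/2} ≤ ℓ` for all `a ≥ a₁` and all `q` (the `a`-exponent of
`λ_q^{-1/2-β+3α/2} λ_{q+1}^β` is `β(b-1) - 1/2 + 3α/2 < 3(α-β)/2 < 0`; BDSV §2.4: "choosing `α`
sufficiently small and `a` sufficiently large we can assume `λ_q^{-3/2} ≤ ℓ ≤ λ_q^{-1}`").
[cite: BuckmasterEtAl2018, §2.4 (2.11)] -/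
theorem exists_threshold_freq_rpow_le_mollScale (hβ : 0 < β) (hb : 1 < b)
    (hbβ : b < (1 - β) / (2 * β)) (hα : α < β) :
    ∃ a₁ : ℝ, 1 < a₁ ∧ ∀ a : ℝ, a₁ ≤ a → ∀ q : ℕ,
      freq a b q ^ (-(3 : ℝ) / 2) ≤ mollScale β α a b q := by
  have h2β : b * (2 * β) < 1 - β := (lt_div_iff₀ (by positivity)).1 hbβ
  have hE : (-(1 / 2) - β + 3 * α / 2) + b * β + b ^ 2 * 0 < 0 := by nlinarith
  obtain ⟨a₁, ha₁, h⟩ := exists_freq_triple_le hb.le hE 1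
  refine ⟨a₁, ha₁, fun a ha q => ?_⟩
  have ha1 : 1 ≤ a := ha₁.le.trans ha
  have hf := freq_pos (b := b) ha1 q
  have hf1 := freq_pos (b := b) ha1 (q + 1)
  have key := h a ha q
  rw [Real.rpow_zero, mul_one, one_mul] at key
  rw [mollScale_eq ha1, le_div_iff₀ (by positivity), ← Real.rpow_add hf, ← Real.rpow_add hf,
    show -(3 : ℝ) / 2 + (-β + (1 + 3 * α / 2)) = -(1 / 2) - β + 3 * α / 2 by ring,
    Real.rpow_neg hf1.le, ← one_div, le_div_iff₀ (Real.rpow_pos_of_pos hf1 β)]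
  exact key

/-- For `a ≥ 1`: `ℓ ≤ 1/4` (indeed `ℓ ≤ λ_q^{-1} ≤ (2π)^{-1}`). [folklore] -/
theorem mollScale_le_quarter (ha : 1 ≤ a) (hb : 1 ≤ b) (hβ : 0 ≤ β) (hα : 0 ≤ α) (q : ℕ) :
    mollScale β α a b q ≤ 1 / 4 := by
  refine (mollScale_le_freq_inv ha hb hβ hα q).trans ?_
  rw [inv_eq_one_div, div_le_div_iff₀ (freq_pos ha q) (by norm_num), one_mul, one_mul]
  linarith [two_pi_le_freq (b := b) ha q, Real.two_le_pi]

end Parameters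

/-! ## The constants and the proof of Prop. 2.2 -/

section Main

/-- The flat three-torus `T³ = (ℝ/ℤ)³`, local notation. -/
local notation "𝕋³" => UnitAddTorus (Fin 3)

/-- Euclidean `ℝ³`, local notation. -/
local notation "ℝ³" => EuclideanSpace ℝ (Fin 3)

/-- **The constants `C_N = C_N(M)` of Prop. 2.2** (they depend on `M` and `N` only):
`C_N = 3c₀M + 27K₀M² + 3M K_N^{vel} + (S_c(N) + 54 M² S_K(N))`, the four summands serving
(2.12), (2.15), (2.13) and (2.14) respectively. [folklore] -/
def mollConst (M : ℝ) (N : ℕ) : ℝ :=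
  3 * derivProfileMass (Fin 3) 0 * M + 27 * commConst (Fin 3) 0 * M ^ 2 + 3 * M * velConst N +
    (tailSum (derivProfileMass (Fin 3)) N + 54 * M ^ 2 * tailSum (commConst (Fin 3)) N)

variable {M : ℝ}

/-- The summands of `C_N` are nonnegative (`M ≥ 0`). [folklore] -/
theorem mollConst_summands_nonneg (hM : 0 ≤ M) (N : ℕ) :
    0 ≤ 3 * derivProfileMass (Fin 3) 0 * M ∧ 0 ≤ 27 * commConst (Fin 3) 0 * M ^ 2 ∧
      0 ≤ 3 * M * velConst N ∧
      0 ≤ tailSum (derivProfileMass (Fin 3)) N + 54 * M ^ 2 * tailSum (commConst (Fin 3)) N := by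
  have h1 := FunctionSpaces.Torus.derivProfileMass_nonneg (d := Fin 3) 0
  have h2 := FunctionSpaces.Torus.commConst_nonneg (d := Fin 3) 0
  have h3 := velConst_nonneg N
  have h4 := tailSum_nonneg (FunctionSpaces.Torus.derivProfileMass_nonneg (d := Fin 3)) N
  have h5 := tailSum_nonneg (FunctionSpaces.Torus.commConst_nonneg (d := Fin 3)) N
  exact ⟨by positivity, by positivity, by positivity, by positivity⟩

/-- **BDSV Prop. 2.2 (the mollification stage) holds.** Discharge of the named fact
`BDSV.mollificationStage`: for `M > 0`, `0 < β < 1/3`, `1 < b < (1-β)/(2β)` take `α₀ = β`; for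
`0 < α < β` take the constants `C_N = mollConst M N` and the threshold `a₀` of
`exists_threshold_freq_rpow_le_mollScale` (so that `λ_q^{-3/2} ≤ ℓ ≤ λ_q^{-1}`, (2.11)); given
an Euler–Reynolds triple with (2.3), (2.4) on `[0,T]`, the triple `(v * ψ_ℓ, p_ℓ, R̊_ℓ)` of
`Torus.IsEulerReynoldsOn.mollify` (BDSV (2.10)) satisfies (2.12)–(2.15) by the slice estimates of
this file: `‖v_ℓ - v‖₀ ≤ ℓ‖Dv‖ ≲ δ_{q+1}^{1/2}λ_q^{-α}`, `‖v_ℓ‖_{N+1} ≲ ℓ^{-N}‖v‖₁`,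
`‖R̊_ℓ‖_{N+α} ≲ ℓ^{-N-α}(‖R̊‖₀ + ℓ²‖v‖₁²) ≲ δ_{q+1}λ_q^{-3α}ℓ^{-N-α} ≤ δ_{q+1}ℓ^{-N+α}`,
`|∫|v|² - |v_ℓ|²| ≲ ℓ²‖v‖₁² ≤ δ_{q+1}ℓ^α` (Buckmaster–De Lellis–Székelyhidi–Vicol 2019, Prop. 2.2
and its proof, §2.4). [cite: BuckmasterEtAl2018, Prop. 2.2] -/
theorem mollificationStage_holds : mollificationStage := by
  intro M hM β hβ hβ3 b hb hbβ
  refine ⟨β, hβ, fun α hα hαβ => ?_⟩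
  obtain ⟨a₁, ha₁, hlow⟩ := exists_threshold_freq_rpow_le_mollScale hβ hb hbβ hαβ
  refine ⟨mollConst M, a₁, ha₁, fun a ha T hT q v p R hER hR hv => ?_⟩
  have ha1 : 1 ≤ a := ha₁.le.trans ha
  have hb1 : 1 ≤ b := hb.le
  obtain ⟨c₀0, K₀0, V0, T0⟩ := mollConst_summands_nonneg hM.le 0
  -- the scales
  set ℓ := mollScale β α a b q with hℓdef
  have hℓ : 0 < ℓ := mollScale_pos ha1 q
  have hℓ4 : ℓ ≤ 1 / 4 := mollScale_le_quarter ha1 hb1 hβ.le hα.le q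
  have hℓ1 : ℓ ≤ 1 := hℓ4.trans (by norm_num)
  have hf := freq_pos (b := b) ha1 q
  have hf1 : 1 ≤ freq a b q := one_le_freq ha1 q
  set S : ℝ := Real.sqrt (amp β a b q) * freq a b q with hSdef
  have hS : 0 < S := mul_pos (Real.sqrt_pos.2 (amp_pos ha1 q)) hf
  set S' : ℝ := Real.sqrt (amp β a b (q + 1)) with hS'def
  have hS' : 0 < S' := Real.sqrt_pos.2 (amp_pos ha1 _)
  have hamp1 : 0 < amp β a b (q + 1) := amp_pos ha1 _
  set G : ℝ := amp β a b (q + 1) * freq a b q ^ (-3 * α) with hGdef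
  have hI1 : ℓ * S = S' * freq a b q ^ (-(3 * α / 2)) := mollScale_mul_sqrt_amp_mul_freq ha1 q
  have hI2 : ℓ ^ 2 * S ^ 2 = G := by
    rw [hGdef, neg_mul]; exact mollScale_sq_mul_sq ha1 q
  have hI3 : freq a b q ^ (-(3 * α / 2)) ≤ freq a b q ^ (-α) :=
    Real.rpow_le_rpow_of_exponent_le hf1 (by linarith)
  have hI4 : freq a b q ^ (-3 * α) ≤ ℓ ^ (2 * α) := by
    have h := Real.rpow_le_rpow (Real.rpow_nonneg hf.le _) (hlow a ha q) (by linarith : 0 ≤ 2 * α)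
    rwa [← Real.rpow_mul hf.le, show -(3 : ℝ) / 2 * (2 * α) = -3 * α by ring] at h
  have hI5 : ℓ ^ (2 * α) ≤ ℓ ^ α := Real.rpow_le_rpow_of_exponent_ge hℓ hℓ1 (by linarith)
  have hℓN : ∀ N : ℕ, (ℓ ^ N)⁻¹ = ℓ ^ (-(N : ℝ)) := fun N => by
    rw [Real.rpow_neg hℓ.le, Real.rpow_natCast]
  -- the data of the triple
  obtain ⟨B₀, B₁, hB₀, hB₁, hBsum⟩ := hv
  have hB₀0 : 0 ≤ B₀ := (norm_nonneg _).trans (hB₀ 0 (left_mem_Icc.2 hT.le) 0)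
  have hB₁0 : 0 ≤ B₁ := (norm_nonneg _).trans (hB₁ 0 0 (left_mem_Icc.2 hT.le) 0)
  have hBS : B₀ + B₁ ≤ M * S := by rw [hSdef, ← mul_assoc]; exact hBsum
  have hA : 3 * B₁ ≤ 3 * (M * S) := by linarith
  have hA' : B₀ + 3 * B₁ ≤ 3 * (M * S) := by linarith
  have hsl : ∀ t ∈ Icc 0 T, IsSmooth (v t) := fun t ht => hER.smooth_velocity.isSmooth_slice ht
  have hsum3 : ∑ _i : Fin 3, B₁ = 3 * B₁ := by
    rw [Finset.sum_const, Finset.card_univ, Fintype.card_fin, nsmul_eq_mul, Nat.cast_ofNat]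
  have hAv : ∀ t ∈ Icc 0 T, ∀ y, ‖FunctionSpaces.Torus.fderiv (v t) y‖ ≤ 3 * B₁ := by
    intro t ht y
    refine (FunctionSpaces.Torus.norm_fderiv_le_sum_norm_partialDeriv
      ((hsl t ht).isContDiff (by simp)) y).trans ?_
    rw [← hsum3]
    exact Finset.sum_le_sum fun i _ => hB₁ i t ht y
  have hAvj : ∀ t ∈ Icc 0 T, ∀ j y, ‖FunctionSpaces.Torus.fderiv (fun z => v t z j) y‖ ≤ 3 * B₁ := by
    intro t ht j y
    have hv1 : IsContDiff 1 (v t) := (hsl t ht).isContDiff (by simp)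
    refine (FunctionSpaces.Torus.norm_fderiv_le_sum_norm_partialDeriv
      (((hsl t ht).apply j).isContDiff (by simp)) y).trans ?_
    rw [← hsum3]
    refine Finset.sum_le_sum fun i _ => ?_
    rw [FunctionSpaces.Torus.partialDeriv_apply_coord hv1, Real.norm_eq_abs]
    exact (FunctionSpaces.Torus.abs_apply_le_norm _ _).trans (hB₁ i t ht y)
  -- the mollified triple
  refine ⟨mollifyVelocity ℓ v, mollifyPressure ℓ v p, mollifyStress ℓ v R, hER.mollify hT hℓ hℓ4,
    ?_, ?_, ?_, ?_⟩
  · -- (2.12)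
    intro t ht x
    have h := norm_kernel_convolution_sub_self_le hℓ hℓ4 (hsl t ht) (hAv t ht) x
    refine h.trans ?_
    calc derivProfileMass (Fin 3) 0 * ℓ * (3 * B₁)
        ≤ derivProfileMass (Fin 3) 0 * ℓ * (3 * (M * S)) :=
          mul_le_mul_of_nonneg_left hA (mul_nonneg (FunctionSpaces.Torus.derivProfileMass_nonneg 0) hℓ.le)
      _ = 3 * derivProfileMass (Fin 3) 0 * M * (S' * freq a b q ^ (-(3 * α / 2))) := by
          rw [← hI1]; ring
      _ ≤ 3 * derivProfileMass (Fin 3) 0 * M * (S' * freq a b q ^ (-α)) :=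
          mul_le_mul_of_nonneg_left (mul_le_mul_of_nonneg_left hI3 hS'.le) c₀0
      _ ≤ mollConst M 0 * (S' * freq a b q ^ (-α)) := by
          refine mul_le_mul_of_nonneg_right ?_ (by positivity)
          unfold mollConst; linarith [(mollConst_summands_nonneg hM.le 0).2.2.1]
  · -- (2.13)
    intro N t ht
    refine (eContDiffHolderNorm_mollifiedVelocity_le hℓ hℓ4 (hsl t ht) (hB₀ t ht) (hAv t ht) N).trans
      (ENNReal.ofReal_le_ofReal ?_)
    rw [hℓN]
    obtain ⟨-, -, VN, -⟩ := mollConst_summands_nonneg hM.le N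
    calc velConst N * (B₀ + 3 * B₁) * ℓ ^ (-(N : ℝ))
        ≤ velConst N * (3 * (M * S)) * ℓ ^ (-(N : ℝ)) :=
          mul_le_mul_of_nonneg_right (mul_le_mul_of_nonneg_left hA' (velConst_nonneg N)) (by positivity)
      _ = 3 * M * velConst N * (S * ℓ ^ (-(N : ℝ))) := by ring
      _ ≤ mollConst M N * (S * ℓ ^ (-(N : ℝ))) := by
          refine mul_le_mul_of_nonneg_right ?_ (by positivity)
          obtain ⟨h1, h2, -, h4⟩ := mollConst_summands_nonneg hM.le N
          unfold mollConst; linarith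
  · -- (2.14)
    intro N t ht
    have hr1 : Real.toNNReal α ≤ 1 := by
      rw [← NNReal.coe_le_coe, Real.coe_toNNReal α hα.le, NNReal.coe_one]; linarith
    have hRt : IsSmooth (R t) := hER.smooth_stress.isSmooth_slice ht
    have h := eContDiffHolderNorm_mollifiedStress_le hℓ hℓ4 (hsl t ht) hRt (hAv t ht) (hAvj t ht)
      (hR t ht) N hr1
    refine h.trans (ENNReal.ofReal_le_ofReal ?_)
    rw [Real.coe_toNNReal α hα.le, hℓN]
    obtain ⟨-, -, -, TN⟩ := mollConst_summands_nonneg hM.le N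
    have hSc := tailSum_nonneg (FunctionSpaces.Torus.derivProfileMass_nonneg (d := Fin 3)) N
    have hSK := tailSum_nonneg (FunctionSpaces.Torus.commConst_nonneg (d := Fin 3)) N
    -- `ℓ² (3B₁)² ≤ 9 M² G`
    have hG9 : ℓ ^ 2 * (3 * B₁) ^ 2 ≤ 9 * M ^ 2 * G := by
      rw [← hI2]
      have : (3 * B₁) ^ 2 ≤ (3 * (M * S)) ^ 2 := pow_le_pow_left₀ (by positivity) hA 2
      nlinarith [sq_nonneg ℓ]
    -- `G ℓ^{-N} ℓ^{-α} ≤ δ_{q+1} ℓ^{-N+α}`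
    have hGpow : G * (ℓ ^ (-(N : ℝ)) * ℓ ^ (-α)) ≤ amp β a b (q + 1) * ℓ ^ (-(N : ℝ) + α) := by
      rw [hGdef, show -(N : ℝ) + α = -(N : ℝ) + -α + 2 * α by ring, Real.rpow_add hℓ,
        Real.rpow_add hℓ, mul_assoc]
      refine mul_le_mul_of_nonneg_left ?_ hamp1.le
      rw [mul_comm]
      exact mul_le_mul_of_nonneg_left hI4 (by positivity)
    calc (tailSum (derivProfileMass (Fin 3)) N * G +
          6 * tailSum (commConst (Fin 3)) N * (ℓ ^ 2 * (3 * B₁) ^ 2)) * (ℓ ^ (-(N : ℝ)) * ℓ ^ (-α))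
        ≤ (tailSum (derivProfileMass (Fin 3)) N * G +
          6 * tailSum (commConst (Fin 3)) N * (9 * M ^ 2 * G)) * (ℓ ^ (-(N : ℝ)) * ℓ ^ (-α)) := by
          gcongr
      _ = (tailSum (derivProfileMass (Fin 3)) N + 54 * M ^ 2 * tailSum (commConst (Fin 3)) N) *
            (G * (ℓ ^ (-(N : ℝ)) * ℓ ^ (-α))) := by ring
      _ ≤ mollConst M N * (amp β a b (q + 1) * ℓ ^ (-(N : ℝ) + α)) := by
          refine mul_le_mul ?_ hGpow (by positivity) ?_
          · obtain ⟨h1, h2, h3, -⟩ := mollConst_summands_nonneg hM.le N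
            unfold mollConst; linarith
          · obtain ⟨h1, h2, h3, h4⟩ := mollConst_summands_nonneg hM.le N
            unfold mollConst; linarith
  · -- (2.15)
    intro t ht
    have h := abs_integral_norm_sq_sub_le hℓ hℓ4 (hsl t ht) (hAvj t ht)
    refine h.trans ?_
    have hG9 : ℓ ^ 2 * (3 * B₁) ^ 2 ≤ 9 * M ^ 2 * G := by
      rw [← hI2]
      have : (3 * B₁) ^ 2 ≤ (3 * (M * S)) ^ 2 := pow_le_pow_left₀ (by positivity) hA 2
      nlinarith [sq_nonneg ℓ]
    have hGα : G ≤ amp β a b (q + 1) * ℓ ^ α :=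
      mul_le_mul_of_nonneg_left (hI4.trans hI5) hamp1.le
    calc 3 * commConst (Fin 3) 0 * ℓ ^ 2 * (3 * B₁) ^ 2
        = 3 * commConst (Fin 3) 0 * (ℓ ^ 2 * (3 * B₁) ^ 2) := by ring
      _ ≤ 3 * commConst (Fin 3) 0 * (9 * M ^ 2 * G) :=
          mul_le_mul_of_nonneg_left hG9 (by linarith [FunctionSpaces.Torus.commConst_nonneg (d := Fin 3) 0])
      _ = 27 * commConst (Fin 3) 0 * M ^ 2 * G := by ring
      _ ≤ 27 * commConst (Fin 3) 0 * M ^ 2 * (amp β a b (q + 1) * ℓ ^ α) :=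
          mul_le_mul_of_nonneg_left hGα K₀0
      _ ≤ mollConst M 0 * (amp β a b (q + 1) * ℓ ^ α) := by
          refine mul_le_mul_of_nonneg_right ?_ (by positivity)
          obtain ⟨h1, -, h3, h4⟩ := mollConst_summands_nonneg hM.le 0
          unfold mollConst; linarith

end Main

end BDSV

end Literature.Analysis.FluidPDE
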